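import Summits.QuantumFields.YangMills.Theorems.ColdStartUniversalityLatticeLangevinHypercontractiveConcentration
import Summits.QuantumFields.YangMills.Theorems.ColdStartUniversalityLatticeLangevinPlaquetteConcentration
import HarnessLib

/-!
# Route `ColdStartUniversality` (fixed-cut-off package, `Lᵖ` side): ★★★ ONE CONFIGURATION OF THE COLD-START SIMULATION MEASURES THE MEAN
# PLAQUETTE to precision `O(L^{-3/2})` after `O(log L)` sweeps, `|β'| < 1/12` — Gaussian concentration of the action density of a single sample

Helper file (seat `ym-line-csu-p1`, g36; `--supports stmt-QuantumFields-24809`).  Combination of g27's volume-uniform concentration of the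
action density under `μ_{β'}` (`wilson_actionDensity_concentration_uniform`: `μ{|S_W/#𝒫 − ⟨S_W/#𝒫⟩| ≥ r} ≤ 2e^{−(1−12|β'|)#𝒫r²/64}`) with
the events form of the `L²`-warm start after the hypercontractive burn-in (`measureReal_map_le_exp_mul_sqrt_uniform`, g36:
`P(U_{2+t₀+u} ∈ A) ≤ e·μ(A)^{1/2}` when `log B ≤ 2(1−12|β'|)t₀`):
* ★★★ `coldStart_actionDensity_concentration_uniform` — for every `L`, `|β'| < 1/12`, every deterministic start (the cold start included),
  EVERY strong solution, all `t₀, u ≥ 0` with `log B ≤ 2(1−12|β'|)t₀`, every `r ≥ 0`: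
  `P[ |S_W(U_{2+t₀+u})/#𝒫 − ∫ S_W/#𝒫 dμ_{β'}| ≥ r ] ≤ e·√2·exp(−(1 − 12|β'|)·#𝒫·r²/128)`;
* `coldStart_actionDensity_concentration_uniform_volume` — the same with `#𝒫 = 3L³`.
Reading: the mean plaquette of ONE configuration, `2 + log B/(2(1−12|β'|)) = O(log L)` lattice time units after a cold start, is within
`x·(3L³)^{-1/2}` of the Gibbs value except with probability `e√2·e^{−(1−12|β'|)x²/128}`, uniformly in the volume.

THEOREMS ONLY, no definition, no sorry.  HONEST FRAMING: RECORD-rung R3 plumbing at FIXED cut-off in LATTICE units, high-temperature window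
`|β'| < 1/12`; the route's scaling `β'_K → ∞` leaves the window; nothing K-uniform; no crux, rung or summit statement is proved; the Yang–Mills
mass gap is NOT proved.
-/

set_option autoImplicit false

noncomputable section

namespace Summit.QuantumFields.YangMills.Theorems.ColdStartUniversality

open MeasureTheory ProbabilityTheory Filter Set Topology
open scoped BigOperators NNReal ENNReal
open Literature.Probability.Process Literature.MathematicalPhysics.QuantumFieldTheory
open Literature.MathematicalPhysics.QuantumLattice (fundamentalRep fundamentalLatticeRep continuous_fundamentalRep)

variable {L : ℕ} [NeZero L]

/-- ★★★ **Gaussian concentration of the action density of ONE sample of the cold-start dynamics after the burn-in.**  For every `L`,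
`|β'| < 1/12`, every deterministic start `z`, EVERY strong solution `U` from `z` on ANY filtered probability space, all `t₀, u ≥ 0` with
`log B ≤ 2(1 − 12|β'|)t₀` (`B = 96|β'|#E + 10|β'|#𝒫 + log 2 + #E·log(3/2)`) and every `r ≥ 0`:
`P[ r ≤ |S_W(U_{2+t₀+u})/#𝒫 − ∫ S_W/#𝒫 dμ_{β'}| ] ≤ e·√2·exp(−(1 − 12|β'|)·#𝒫·r²/128)`.
[cite: ShenZhuZhu2022, §4 Theorem 4.2, Corollary 4.4] [cite: DiaconisSaloffcoste1996, Theorem 3.7] -/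
theorem coldStart_actionDensity_concentration_uniform (L : ℕ) [NeZero L] (β' : ℝ) (hβ : |β'| < 1 / 12)
    (z : GaugeConfig 3 L (Matrix.specialUnitaryGroup (Fin 2) ℂ))
    {Ω : Type} [MeasurableSpace Ω] {P : Measure Ω} [IsProbabilityMeasure P]
    {W : ℝ≥0 → Ω → (Edge 3 L × NoiseIdx 2 → ℝ)} (hW : IsFlatBrownian W P)
    {U : ℝ≥0 → Ω → GaugeConfig 3 L (Matrix.specialUnitaryGroup (Fin 2) ℂ)} (hU0 : ∀ ω, U 0 ω = z)
    (hU : (latticeLangevinDynamics (fundamentalLatticeRep 2) β').IsSolution (fundamentalRep (Fin 2)) hW.natFiltration P W U)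
    (t₀ u : ℝ≥0)
    (ht₀ : Real.log (96 * |β'| * (Fintype.card (Edge 3 L) : ℝ) + 10 * |β'| * (Fintype.card (Plaquette 3 L) : ℝ) + Real.log 2 +
      (Fintype.card (Edge 3 L) : ℝ) * Real.log (3 / 2)) ≤ 2 * (1 - 12 * |β'|) * t₀)
    {r : ℝ} (hr : 0 ≤ r) :
    P.real {ω | r ≤ |wilsonAction (fundamentalRep (Fin 2)) (U (2 + t₀ + u) ω) / (Fintype.card (Plaquette 3 L) : ℝ) -
        ∫ V', wilsonAction (fundamentalRep (Fin 2)) V' / (Fintype.card (Plaquette 3 L) : ℝ)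
          ∂(wilsonMeasure (d := 3) (L := L) (fundamentalRep (Fin 2)) β')|} ≤
      Real.exp 1 * Real.sqrt 2 * Real.exp (-((1 - 12 * |β'|) * (Fintype.card (Plaquette 3 L) : ℝ) * r ^ 2 / 128)) := by
  classical
  haveI := secondCountableTopology_su2
  haveI := borelSpace_config L
  haveI : IsProbabilityMeasure (wilsonMeasure (d := 3) (L := L) (fundamentalRep (Fin 2)) β') :=
    isProbabilityMeasure_wilsonMeasure (d := 3) (L := L) (fundamentalRep (Fin 2)) (continuous_fundamentalRep (Fin 2)) β'
  set m : ℝ := ∫ V', wilsonAction (fundamentalRep (Fin 2)) V' / (Fintype.card (Plaquette 3 L) : ℝ)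
    ∂(wilsonMeasure (d := 3) (L := L) (fundamentalRep (Fin 2)) β') with hm
  set A : Set (GaugeConfig 3 L (Matrix.specialUnitaryGroup (Fin 2) ℂ)) :=
    {V | r ≤ |wilsonAction (fundamentalRep (Fin 2)) V / (Fintype.card (Plaquette 3 L) : ℝ) - m|} with hAdef
  have hdc : Continuous fun V : GaugeConfig 3 L (Matrix.specialUnitaryGroup (Fin 2) ℂ) =>
      wilsonAction (fundamentalRep (Fin 2)) V / (Fintype.card (Plaquette 3 L) : ℝ) :=
    continuous_wilsonAction_su2.div_const _
  have hA : MeasurableSet A := measurableSet_le measurable_const ((hdc.sub continuous_const).abs).measurable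
  have hmU : Measurable (U (2 + t₀ + u)) := (hU.adapted _).mono (hW.natFiltration.le _) le_rfl
  have hev : P.real {ω | r ≤ |wilsonAction (fundamentalRep (Fin 2)) (U (2 + t₀ + u) ω) / (Fintype.card (Plaquette 3 L) : ℝ) - m|} =
      (P.map (U (2 + t₀ + u))).real A := by
    rw [measureReal_def, measureReal_def, Measure.map_apply hmU hA]; rfl
  rw [hev]
  have h1 := measureReal_map_le_exp_mul_sqrt_uniform L β' hβ z hW hU0 hU hA t₀ u ht₀
  have h2 : (wilsonMeasure (d := 3) (L := L) (fundamentalRep (Fin 2)) β').real A ≤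
      2 * Real.exp (-((1 - 12 * |β'|) * (Fintype.card (Plaquette 3 L) : ℝ) * r ^ 2 / 64)) :=
    wilson_actionDensity_concentration_uniform L β' hβ r hr
  have h3 : ((wilsonMeasure (d := 3) (L := L) (fundamentalRep (Fin 2)) β').real A) ^ (1 / (2 : ℝ)) ≤
      Real.sqrt 2 * Real.exp (-((1 - 12 * |β'|) * (Fintype.card (Plaquette 3 L) : ℝ) * r ^ 2 / 128)) := by
    have h := Real.rpow_le_rpow measureReal_nonneg h2 (by norm_num : (0 : ℝ) ≤ 1 / 2)
    have e : (2 * Real.exp (-((1 - 12 * |β'|) * (Fintype.card (Plaquette 3 L) : ℝ) * r ^ 2 / 64))) ^ (1 / (2 : ℝ)) =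
        Real.sqrt 2 * Real.exp (-((1 - 12 * |β'|) * (Fintype.card (Plaquette 3 L) : ℝ) * r ^ 2 / 128)) := by
      rw [Real.mul_rpow (by norm_num) (Real.exp_pos _).le, Real.sqrt_eq_rpow, ← Real.exp_mul]
      congr 2; ring
    rw [e] at h; exact h
  calc _ ≤ _ := h1
    _ ≤ Real.exp 1 * (Real.sqrt 2 * Real.exp (-((1 - 12 * |β'|) * (Fintype.card (Plaquette 3 L) : ℝ) * r ^ 2 / 128))) :=
        mul_le_mul_of_nonneg_left h3 (Real.exp_pos 1).le
    _ = _ := by ring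

/-- **The same with `#𝒫 = 3L³` spelled out**: `P[ r ≤ |S_W(U_{2+t₀+u})/(3L³) − ⟨S_W/(3L³)⟩_{μ_{β'}}| ] ≤ e·√2·exp(−(1 − 12|β'|)·3L³·r²/128)`
— at the CLT scale `r = x·(3L³)^{-1/2}` the bound `e√2·e^{−(1−12|β'|)x²/128}` is volume-independent. [cite: ShenZhuZhu2022, §4 Corollary 4.4] -/
theorem coldStart_actionDensity_concentration_uniform_volume (L : ℕ) [NeZero L] (β' : ℝ) (hβ : |β'| < 1 / 12)
    (z : GaugeConfig 3 L (Matrix.specialUnitaryGroup (Fin 2) ℂ))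
    {Ω : Type} [MeasurableSpace Ω] {P : Measure Ω} [IsProbabilityMeasure P]
    {W : ℝ≥0 → Ω → (Edge 3 L × NoiseIdx 2 → ℝ)} (hW : IsFlatBrownian W P)
    {U : ℝ≥0 → Ω → GaugeConfig 3 L (Matrix.specialUnitaryGroup (Fin 2) ℂ)} (hU0 : ∀ ω, U 0 ω = z)
    (hU : (latticeLangevinDynamics (fundamentalLatticeRep 2) β').IsSolution (fundamentalRep (Fin 2)) hW.natFiltration P W U)
    (t₀ u : ℝ≥0)
    (ht₀ : Real.log (96 * |β'| * (Fintype.card (Edge 3 L) : ℝ) + 10 * |β'| * (Fintype.card (Plaquette 3 L) : ℝ) + Real.log 2 +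
      (Fintype.card (Edge 3 L) : ℝ) * Real.log (3 / 2)) ≤ 2 * (1 - 12 * |β'|) * t₀)
    {r : ℝ} (hr : 0 ≤ r) :
    P.real {ω | r ≤ |wilsonAction (fundamentalRep (Fin 2)) (U (2 + t₀ + u) ω) / (3 * (L : ℝ) ^ 3) -
        ∫ V', wilsonAction (fundamentalRep (Fin 2)) V' / (3 * (L : ℝ) ^ 3)
          ∂(wilsonMeasure (d := 3) (L := L) (fundamentalRep (Fin 2)) β')|} ≤
      Real.exp 1 * Real.sqrt 2 * Real.exp (-((1 - 12 * |β'|) * (3 * (L : ℝ) ^ 3) * r ^ 2 / 128)) := by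
  have hP : (Fintype.card (Plaquette 3 L) : ℝ) = 3 * (L : ℝ) ^ 3 := by
    rw [card_plaquette_three]; push_cast; ring
  have h := coldStart_actionDensity_concentration_uniform L β' hβ z hW hU0 hU t₀ u ht₀ hr
  rw [hP] at h
  exact h

end Summit.QuantumFields.YangMills.Theorems.ColdStartUniversality

end
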